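/-
Copyright (c) 2026 the pub-hodgecm-mathlib formalisation cell (harness21).  Prover seat hodgecm-mathlib-R90-C10-p05 (g2), R90-TF SLAB section S1 «Ch10-local» (base
R90-C10), h413 = `stmt-HodgeConjecture-24833`; line «B_pos» (U4Keys :182 in BRANCH B at positive depth, memo `R90/R90-C10-p05/g2/DESIGN-Bpos-inert.md`, RULING R-S1-11∕12
of the S1 chair R90-C10-plan (g2)): brick (B-2b), MODEL half — «THE THREE-WAY BRUHAT COVER OF `U(σ, Φ₃)(K)` RELATIVE TO A TWO-DEPTH LEVEL GROUP `J_e`»: every element lies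
in `P·J_e`, in `P·w·J_e`, or in `P·n̄·J_e` for a lower unipotent `n̄` off `J_e` and off the sharp big cell.  2026-09-05.
-/
import Summits.HodgeConjecture.HodgeConjecture.Theorems.K2E3LowerUnipotentDeepCellTwoDepth   -- ★ p862537 (K2E3-p34 (g2)): the sharp big cell `|x∕z| ≤ |ϖ|^{e 0 1}`, `|z| ≥ |ϖ|^{-e 0 2}` lies in `P·w·J_e`; brings ★ p861613 `exists_borel_mul_weylLongU_mul_upper`, `div_rel`, ★ D174, ★ Bruhat `mem_borelU_or_exists_eq_mul_weylLongU_mul`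
import HarnessLib

/-!
# R90-TF S1 «Ch10-local» ∕ K2 E3 «U4Keys» :182, BRANCH B AT POSITIVE DEPTH — brick (B-2b), model half: THE THREE-WAY COVER
# `U(σ, Φ₃)(K) = P·J_e ∪ P·w·J_e ∪ ⋃_{n̄ ∈ R} P·n̄·J_e`, `R` = the lower unipotents off `J_e` and off the sharp big cell
# [Rogawski1990 §1.10; Casselman1995 Prop. 1.3.1; BruhatTits1972 (4.4.4), (6.4.9); Roche1998 §3–§4]

Cell `pub/hodgecm-mathlib`, crux H413 = `stmt-HodgeConjecture-24833`, route of record `HCCMUnconditional` (no route verbs); R90-TF section S1 (junction socket A2′ of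
`Cruxes/H413/Lines/R90_S1_NonsplitLocalPacketsA.lean` = U4Keys :217, REL over :155 and :182).  THEOREMS ONLY (no `def`, no `instance`, no `notation`, no named-fact
hypothesis, no `sorry`); lane `--supports stmt-HodgeConjecture-24833 --as helper`, count-neutral.  MODEL level (`U(σ, Φ₃)(K)`, `K` with `Valued K ℤᵐ⁰`, an isometric involution
`σ`, a uniformiser `ϖ`; letters of ★ D174: an exponent matrix `e` and the level group `(Jg, hJg)`).  NOT THE PAYER of :182.

THE POINT.  The Branch-B engine at positive depth (★-pending (B-0) `R90S1BranchBDeterminantVanishingCells.det_intertwiningIntegral_eq_zero_of_typeVector_of_cells`) needs the cover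
letter `hcells : ∀ y, y ∈ P·B ∨ y ∈ P·g₀·B ∨ ∃ r ∈ R, y ∈ P·r·B` for `B = J_e` and a family `R` of IRRELEVANT cells (each carrying a depth witness, ★ p862990
`K2E3BranchAIrreducibleTwoDepthCells.exists_shellWitness_of_mem_map_of_not_mem`).  At the Iwahori `I` the cover is two-celled (★ `cover_borelU_inf`); at `J_e` it is the Bruhat
decomposition `G = B ⊔ B·w·N` (★ `mem_borelU_or_exists_eq_mul_weylLongU_mul`) followed, on the big cell, by `w·u(y, c) = p·ū(y∕c, 1∕c)` (the big-cell formula ★ p861613 read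
backwards, §1) and the TRICHOTOMY of the lower unipotent `ū`: in `J_e` (closed cell), SHARP (`|x∕z| ≤ |ϖ|^{e 0 1}` and `|z| ≥ |ϖ|^{-e 0 2}`: then `ū ∈ P·w·J_e`, ★ p862537), or a SHELL
representative `ū ∈ R := {n̄ ∈ w N w : n̄ ∉ J_e, n̄ not sharp}` (§2).  `R` is written as a set-builder over ★ p862990's three letters `hr`, `hoff`, `hshal`, so that the CM half
(B-2b′) feeds ★ p862990 cell by cell.
* §1 `one_of_coe_eq_upper_of_eq_zero` (`u(y, 0) = 1`), **`exists_borel_mul_lower_of_weylLongU_mul`** (`w·u = p·n̄`, `n̄ ∈ w N w`, for `u ∈ N ∖ {1}`).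
* §2 **`cover_cells_twoDepth`** — the three-way cover (letters `he0`, `hsym` of ★ p862537).
HONEST LABEL.  HC_CM is proved only modulo the 7 printed citations (2 remaining named inputs: hLiu418 = `stmt-HodgeConjecture-24832`, h413 = `stmt-HodgeConjecture-24833`) until rung 0
closes; count-neutral — group theory; this file does NOT pay :182 or A2′; no printed citation is discharged.

## References
* [Rogawski1990] J. D. Rogawski, *Automorphic Representations of Unitary Groups in Three Variables*, Ann. of Math. Stud. 123 (1990), §1.10 p. 9 (`G = B ⊔ BwN`, `N̄ = wNw`).
* [Casselman1995] W. Casselman, *Introduction to the theory of admissible representations of `p`-adic reductive groups* (1995), Prop. 1.3.1 (Bruhat decomposition), §6.3.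
* [BruhatTits1972] F. Bruhat, J. Tits, *Groupes réductifs sur un corps local I*, Publ. Math. IHÉS 41 (1972), (4.4.4), (6.4.9) (the groups `U_f⁻ H U_f⁺`).
* [Roche1998] A. Roche, *Types and Hecke algebras for principal series representations of split reductive p-adic groups*, Ann. Sci. ÉNS (4) 31 (1998), §3–§4 (the cells
  `P g J_χ` and their relevance).
-/

set_option autoImplicit false
-- the mandated namespace repeats the single-problem summit's segment (`HodgeConjecture.HodgeConjecture`)
set_option linter.dupNamespace false

noncomputable section

open Matrix Literature.NumberTheory.Automorphic Literature.NumberTheory.Automorphic.UnitaryGroup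
open scoped Matrix MatrixGroups WithZero

namespace Summit.HodgeConjecture.HodgeConjecture.R90.S1.BposBruhatCellsTwoDepth

open Summit.HodgeConjecture.HodgeConjecture.Cruxes.H413

variable {K : Type*} [Field K] [Valued K ℤᵐ⁰]
  (σ : K →+* K) {ϖ : K} {J : Matrix (Fin 3) (Fin 3) K} (hJ : J = (StdForm.antidiagonal 3).over K)
  (hσ : ∀ a, σ (σ a) = a) (hvσ : ∀ a, Valued.v (σ a) = Valued.v a) (hvϖ : Valued.v ϖ = WithZero.exp (-1 : ℤ))
  (e : Fin 3 → Fin 3 → ℕ) (Jg : Subgroup ↥(unitaryGroupOfForm σ J))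
  (hJg : ∀ k : ↥(unitaryGroupOfForm σ J), k ∈ Jg ↔ ∀ i j, Valued.v (((k : GL (Fin 3) K) : Matrix (Fin 3) (Fin 3) K) i j) ≤ Valued.v ϖ ^ e i j)

/-! ## §1 The big cell read backwards: `w · u(y, c) = p · ū(y∕c, 1∕c)` -/

omit [Valued K ℤᵐ⁰] in
/-- `u(y, 0) = 1`: on the Heisenberg quadric `c + σc + yσy = 0`, `c = 0` forces `y = 0`. [cite: Rogawski1990, §1.10 p. 9] -/
theorem one_of_coe_eq_upper_of_eq_zero {u : ↥(unitaryGroupOfForm σ J)} {y c : K}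
    (hu : ((u : GL (Fin 3) K) : Matrix (Fin 3) (Fin 3) K) = !![1, y, c; 0, 1, -σ y; 0, 0, 1]) (hrel : c + σ c + y * σ y = 0) (hc : c = 0) : u = 1 := by
  subst hc
  have hy : y = 0 := by
    rw [map_zero, zero_add, zero_add] at hrel
    rcases mul_eq_zero.1 hrel with h | h
    · exact h
    · exact (map_eq_zero σ).1 h
  subst hy
  apply Subtype.ext
  apply Units.ext
  rw [hu, OneMemClass.coe_one, Units.val_one]
  ext i j
  fin_cases i <;> fin_cases j <;> simp

omit [Valued K ℤᵐ⁰] in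
include hJ hσ in
/-- **`w · u = p · n̄` with `p ∈ P` and `n̄ ∈ N̄ = wNw`** for `u ∈ N`, `u ≠ 1`: `u = u(y, c)` (★ `exists_coe_eq_upper_of_mem_unipotentU`) has `c ≠ 0`, and the big-cell formula ★ p861613
`exists_borel_mul_weylLongU_mul_upper` for `n̄ := ū(y∕c, 1∕c)` (★ `exists_coe_eq_lower`, relation ★ `div_rel`) reads `n̄ = p′ · w · u(y, c) = p′ · w · u`, i.e. `w u = p′⁻¹ n̄`.
Print: the point `P·w·u(y, c)` of `P∖G` is the point `P·ū(y∕c, 1∕c)` of the big cell `N̄`. [cite: Rogawski1990, §1.10 p. 9] [cite: Casselman1995, Prop. 1.3.1] -/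
theorem exists_borel_mul_lower_of_weylLongU_mul {u : ↥(unitaryGroupOfForm σ J)} (hu : u ∈ unipotentU σ J) (hu1 : u ≠ 1) :
    ∃ p ∈ borelU σ J, ∃ nb ∈ ((borelTriple σ J hJ).N).map (MulAut.conj (weylLongU σ hJ)).toMonoidHom, weylLongU σ hJ * u = p * nb := by
  obtain ⟨y, c, huM, hrel⟩ := exists_coe_eq_upper_of_mem_unipotentU σ hJ hσ hu
  have hc : c ≠ 0 := fun h => hu1 (one_of_coe_eq_upper_of_eq_zero σ huM hrel h)
  -- `n̄ := ū(y∕c, 1∕c)` on the quadric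
  have hrel' : c⁻¹ + σ c⁻¹ + y / c * σ (y / c) = 0 := K2E3LowerUnipotentBigCellIntegral.div_rel σ hrel hc
  obtain ⟨nb, hnb⟩ := exists_coe_eq_lower σ hJ hσ hrel'
  -- the big-cell formula: `n̄ = p′ · w · u′`, `u′ = u((y∕c)∕c⁻¹, (c⁻¹)⁻¹) = u(y, c) = u`
  obtain ⟨p', u', hp', hu'N, hu', heq⟩ := K2E3LowerUnipotentBigCellIntegral.exists_borel_mul_weylLongU_mul_upper σ hJ hσ hnb hrel' (inv_ne_zero hc)
  have hyc : y / c / c⁻¹ = y := by rw [div_eq_mul_inv, div_eq_mul_inv, inv_inv, mul_assoc, inv_mul_cancel₀ hc, mul_one]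
  have hu'u : u' = u := by
    apply Subtype.ext
    apply Units.ext
    rw [hu', huM, hyc, inv_inv]
  rw [hu'u] at heq
  -- `n̄ ∈ wNw` (its `w`-conjugate is upper unitriangular)
  have hw : weylLongU σ hJ * weylLongU σ hJ = 1 := weylLongU_mul_weylLongU σ hJ
  have hwinv : (weylLongU σ hJ)⁻¹ = weylLongU σ hJ := inv_eq_of_mul_eq_one_right hw
  have hlow : ∀ i j : Fin 3, i < j → ((nb : GL (Fin 3) K) : Matrix (Fin 3) (Fin 3) K) i j = 0 := by
    intro i j hij
    rw [hnb]
    fin_cases i <;> fin_cases j <;> first | rfl | exact absurd hij (by decide)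
  have hdiag : ∀ i : Fin 3, ((nb : GL (Fin 3) K) : Matrix (Fin 3) (Fin 3) K) i i = 1 := by
    intro i
    rw [hnb]
    fin_cases i <;> rfl
  have hnbN : nb ∈ ((borelTriple σ J hJ).N).map (MulAut.conj (weylLongU σ hJ)).toMonoidHom := by
    refine Subgroup.mem_map.2 ⟨weylLongU σ hJ * nb * weylLongU σ hJ, weylLongU_mul_mul_weylLongU_mem_unipotentU σ hJ hlow hdiag, ?_⟩
    rw [MulEquiv.coe_toMonoidHom, MulAut.conj_apply, hwinv, ← mul_assoc, ← mul_assoc, hw, one_mul, mul_assoc, hw, mul_one]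
  refine ⟨p'⁻¹, inv_mem hp', nb, hnbN, ?_⟩
  rw [heq, mul_assoc, inv_mul_cancel_left]

/-! ## §2 The three-way cover -/

include hJ hσ hvσ hvϖ hJg in
/-- **THE THREE-WAY COVER OF `U(σ, Φ₃)(K)` BY `(P, J_e)`-CELLS.**  For a two-sided exponent matrix `e` (`e i i = 0`, anti-transpose symmetric — the letters of ★ p862537) and
the level group `J_e` (`hJg`), every `y` lies in the CLOSED cell `P·J_e`, in the SHARP big cell `P·w·J_e`, or in `P·n̄·J_e` for a SHELL representative `n̄ ∈ R`, where
`R = {n̄ ∈ wNw : n̄ ∉ J_e ∧ ¬(|n̄₂₁∕n̄₂₀| ≤ |ϖ|^{e 0 1} ∧ |ϖ|^{-e 0 2} ≤ |n̄₂₀|)}` (the letters `hr`, `hoff`, `hshal` of ★ p862990, negated sharpness in ★ p862537's entry form).  Bruhat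
`G = P ⊔ P·w·N` (★ `mem_borelU_or_exists_eq_mul_weylLongU_mul`), §1 on the big cell, then the trichotomy of `n̄` (★ p862537 `exists_borel_mul_weylLongU_mul_mem_of_v_apply_div_le`
for the sharp case).  This is the letter `hcells` of ★-pending (B-0) at `B := J_e`. [cite: Rogawski1990, §1.10 p. 9] [cite: Casselman1995, Prop. 1.3.1, §6.3]
[cite: BruhatTits1972, (4.4.4), (6.4.9)] [cite: Roche1998, §3–§4] -/
theorem cover_cells_twoDepth (he0 : ∀ i, e i i = 0) (hsym : ∀ i j, e (Fin.rev j) (Fin.rev i) = e i j) :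
    ∀ y : ↥(unitaryGroupOfForm σ J),
      (∃ h ∈ borelU σ J, ∃ b ∈ Jg, y = h * b) ∨
      (∃ h ∈ borelU σ J, ∃ b ∈ Jg, y = h * weylLongU σ hJ * b) ∨
      ∃ r ∈ {nb : ↥(unitaryGroupOfForm σ J) | nb ∈ ((borelTriple σ J hJ).N).map (MulAut.conj (weylLongU σ hJ)).toMonoidHom ∧ nb ∉ Jg ∧
          ¬ (Valued.v (((nb : GL (Fin 3) K) : Matrix (Fin 3) (Fin 3) K) 2 1 / ((nb : GL (Fin 3) K) : Matrix (Fin 3) (Fin 3) K) 2 0) ≤ Valued.v ϖ ^ e 0 1 ∧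
            (Valued.v ϖ ^ e 0 2)⁻¹ ≤ Valued.v (((nb : GL (Fin 3) K) : Matrix (Fin 3) (Fin 3) K) 2 0))},
        ∃ h ∈ borelU σ J, ∃ b ∈ Jg, y = h * r * b := by
  intro y
  rcases mem_borelU_or_exists_eq_mul_weylLongU_mul σ hJ y with hy | ⟨b, hb, u, hu, rfl⟩
  · -- the small Bruhat cell `P ⊆ P·J_e`
    exact Or.inl ⟨y, hy, 1, Jg.one_mem, (mul_one y).symm⟩
  · by_cases hu1 : u = 1
    · -- `y = b·w ∈ P·w·J_e`
      subst hu1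
      exact Or.inr (Or.inl ⟨b, hb, 1, Jg.one_mem, rfl⟩)
    · -- `y = b·(w u) = (b p)·n̄`
      obtain ⟨p, hp, nb, hnbN, hwu⟩ := exists_borel_mul_lower_of_weylLongU_mul σ hJ hσ hu hu1
      have hy : b * weylLongU σ hJ * u = b * p * nb := by rw [mul_assoc b, hwu, ← mul_assoc]
      by_cases hJ1 : nb ∈ Jg
      · exact Or.inl ⟨b * p, mul_mem hb hp, nb, hJ1, hy⟩
      · by_cases hsharp : Valued.v (((nb : GL (Fin 3) K) : Matrix (Fin 3) (Fin 3) K) 2 1 / ((nb : GL (Fin 3) K) : Matrix (Fin 3) (Fin 3) K) 2 0) ≤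
            Valued.v ϖ ^ e 0 1 ∧ (Valued.v ϖ ^ e 0 2)⁻¹ ≤ Valued.v (((nb : GL (Fin 3) K) : Matrix (Fin 3) (Fin 3) K) 2 0)
        · -- the sharp big cell: `n̄ = p′·w·u′`, `u′ ∈ J_e`
          obtain ⟨p', hp', u', hu', heq⟩ := K2E3LowerUnipotentDeepCellTwoDepth.exists_borel_mul_weylLongU_mul_mem_of_v_apply_div_le σ hJ hσ hvσ hvϖ e Jg hJg
            he0 hsym hnbN hsharp.1 hsharp.2
          refine Or.inr (Or.inl ⟨b * p * p', mul_mem (mul_mem hb hp) hp', u', hu', ?_⟩)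
          rw [hy, heq, ← mul_assoc, ← mul_assoc]
        · -- a shell representative
          refine Or.inr (Or.inr ⟨nb, ⟨hnbN, hJ1, hsharp⟩, b * p, mul_mem hb hp, 1, Jg.one_mem, ?_⟩)
          rw [hy, mul_one]

end Summit.HodgeConjecture.HodgeConjecture.R90.S1.BposBruhatCellsTwoDepth

end
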